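import Summits.QuantumFields.YangMills.Theorems.LuscherReductionTwistedTraceScalingSlowShadow
import Summits.QuantumFields.YangMills.Theorems.LuscherReductionTwistedTraceScalingRecordBricks
import HarnessLib

/-!
# The shadow field of `RecordBOInput` for the record weight: `δ₁ = 14·β^{-s}/L³` works
# (lane A of S-BASE, crux `TwistedTraceScaling` stmt-QuantumFields-20203, C4 INNER; design note `pub/ym-fleet/ym-luscher-20007-p1/COARSE-DESIGN.md` §24.8)

From (S1) `orbitDist_slowMean_le` (`…SlowShadow`): eventually in `β`, every `U` in the support of `recordChi L s K M β` (links within `MKβ^{-s}` of `1`) with `orbitDist U < β^{-s}` has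
`orbitDist (slowMean U) < 14·β^{-s}/N`, `N = |Site| = L³`.  So `RecordBOInput.hshadow` holds with `δ₁ β = 14·powScale s β/N` (and then `hδ₁`, and `hradii` with any `K > 42` once
`12N·r β < powScale s β`); `hcore` (`13(L³β)^{-1/5} < δ₁ β`) is the window condition `s < 1/5`.
* ★★ `recordChi_shadow` — the eventual shadow bound.
HONEST FRAMING: structural field for a stub of a child of the CONDITIONAL reduction route R2b1; analytic bricks OPEN; C4 OPEN; not a gap, not Clay.
-/

set_option autoImplicit false

noncomputable section

open MeasureTheory Filter Topology Real
open scoped BigOperators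
open Literature.MathematicalPhysics.QuantumFieldTheory
open Literature.MathematicalPhysics.QuantumLattice

namespace Summit.QuantumFields.YangMills.Theorems.FemtoTransferGap.TwoLattice.ConstTube

open Summit.QuantumFields.YangMills.Theorems.FemtoTransferGap

variable {L : ℕ} [NeZero L]

/-- ★★ **THE SHADOW OF THE RECORD TUBE**: eventually in `β`, `recordChi L s K M β U ≠ 0 ∧ orbitDist U < β^{-s} ⇒ orbitDist (slowMean U) < 14·β^{-s}/|Site|` (`s > 0`, `K, M ≥ 0`).
[folklore] -/
theorem recordChi_shadow {s K M : ℝ} (hs : 0 < s) (hK : 0 ≤ K) (hM : 0 ≤ M) :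
    ∀ᶠ β : ℝ in atTop, ∀ U : GaugeConfig 3 L SU2, recordChi L s K M β U ≠ 0 → orbitDist U < powScale s β →
      orbitDist (slowMean L U) < 14 * powScale s β / Fintype.card (Site 3 L) := by
  set N : ℝ := (Fintype.card (Site 3 L) : ℝ) with hNdef
  have hN : 0 < N := by rw [hNdef]; exact_mod_cast Fintype.card_pos
  have hN1 : 1 ≤ N := by rw [hNdef]; exact_mod_cast Fintype.card_pos
  have hL1 : (1 : ℝ) ≤ L := by exact_mod_cast NeZero.one_le
  have hδt := tendsto_powScale hs
  -- eventually: `3 L N (MK+1)² δ ≤ 1/12` and `2δ < N/2`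
  have hA : 0 < 3 * L * N * (M * K + 1) ^ 2 := by positivity
  filter_upwards [hδt.eventually (gt_mem_nhds (show (0 : ℝ) < 1 / (12 * (3 * L * N * (M * K + 1) ^ 2)) by positivity)),
    hδt.eventually (gt_mem_nhds (show (0 : ℝ) < 1 / 4 by norm_num))] with β hβ1 hβ2 U hU hUδ
  set δ : ℝ := powScale s β with hδdef
  have hδ0 : 0 < δ := powScale_pos s β
  obtain ⟨-, hmem⟩ := (recordChi_props (L := L) s K M β).2.2.2 U hU
  have hnear : U ∈ nearOne L (M * (K * δ)) := hmem.1
  -- the quadratic term is at most `δ/12`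
  have hq : 3 * L * N * (M * (K * δ) + δ) ^ 2 ≤ δ / 12 := by
    have e : 3 * L * N * (M * (K * δ) + δ) ^ 2 = (3 * L * N * (M * K + 1) ^ 2 * δ) * δ := by ring
    rw [e]
    have h1 : 3 * L * N * (M * K + 1) ^ 2 * δ ≤ 1 / 12 := by
      have := (lt_div_iff₀ (by positivity : (0 : ℝ) < 12 * (3 * L * N * (M * K + 1) ^ 2))).mp hβ1
      linarith
    have := mul_le_mul_of_nonneg_right h1 hδ0.le
    linarith
  have hsmall : δ + 3 * L * N * (M * (K * δ) + δ) ^ 2 < N / 2 := by nlinarith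
  have h := orbitDist_slowMean_le hnear hUδ hsmall
  calc orbitDist (slowMean L U) ≤ 12 * (δ + 3 * L * N * (M * (K * δ) + δ) ^ 2) / N := h
    _ ≤ 12 * (δ + δ / 12) / N := by gcongr
    _ = 13 * δ / N := by ring
    _ < 14 * δ / N := by rw [div_lt_div_iff_of_pos_right hN]; linarith

end Summit.QuantumFields.YangMills.Theorems.FemtoTransferGap.TwoLattice.ConstTube

end
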